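import Literature.Topology.PlanarFoliations.LeafOrder
import Mathlib.Topology.DiscreteSubset
import HarnessLib

/-!
# Crossings of an open leaf with the verticals of a flow box

Topic: Topology / PlanarFoliations, sequel to `LeafOrder.lean`: the first ingredients of the
Poincaré–Bendixson theory of a bi-oriented foliation with one-dimensional leaves. A **vertical**
of a flow box `e` of the atlas is a curve `t ↦ e.symm (u₀, t)`, transverse to the foliation; a
**crossing** of the open leaf `L = F.Leaf x` (ordered by `leafLT`, `LeafOrder.lean`) with the
vertical `u = u₀` of `e` is a point of `L` whose `e`-leaf-coordinate is `u₀`.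

* `IsCrossing` (**definition**), the height of a crossing;
* **crossings are left to right** (`eventually_leafLT_iff_lt_fst`): near a crossing `p`, the
  points of `L` after `p` are those read to the right of the vertical (`u₀ < u`), the points
  before `p` those to its left — the bi-orientation read on the plaque through `p`
  (`leafArc_lt_iff`);
* hence **crossings are isolated along the leaf** (`eventually_not_isCrossing`), the crossings
  with heights in a closed set form a closed discrete subset of the leaf, **finite in every
  order interval** (`finite_crossings_leafIcc`), and among the crossings after a point in an
  interval there is a **first one** (`exists_first_crossing`).

All statements are [folklore] (the elementary part of the Poincaré–Bendixson theory, e.g.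
Camacho–Lins Neto Ch. VI §4; Hector–Hirsch A Ch. II).
-/

noncomputable section

open Set Filter Function
open _root_.Topology
open Literature.Topology.FourManifolds Literature.Topology.FourManifolds.Foliation
  Literature.Topology.FourManifolds.OneManifold

namespace Literature.Topology.PlanarFoliations

variable {X : Type*} [TopologicalSpace X] {F : Foliation ℝ X} {x : X}
variable {e : OpenPartialHomeomorph X (ℝ × ℝ)} {u₀ : ℝ}

/-! ## Crossings -/

/-- The underlying point of `X` of a point of the leaf. [folklore] -/
abbrev Leaf.pt (p : F.Leaf x) : X := ofLeafSpace (p : F.LeafSpace)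

/-- `p` is a **crossing** of the leaf with the vertical `u = u₀` of the flow box `e`: it lies in
the box with leaf coordinate `u₀`. [folklore] -/
def IsCrossing (e : OpenPartialHomeomorph X (ℝ × ℝ)) (u₀ : ℝ) (p : F.Leaf x) : Prop :=
  Leaf.pt p ∈ e.source ∧ (e (Leaf.pt p)).1 = u₀

/-- The **height** of a point of the leaf in the flow box `e`. [folklore] -/
def ht (e : OpenPartialHomeomorph X (ℝ × ℝ)) (p : F.Leaf x) : ℝ := (e (Leaf.pt p)).2

/-- A crossing is the point of the vertical at its height. [folklore] -/
theorem IsCrossing.pt_eq {p : F.Leaf x} (hp : IsCrossing e u₀ p) : Leaf.pt p = e.symm (u₀, ht e p) := by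
  rw [← hp.2, show ((e (Leaf.pt p)).1, ht e p) = e (Leaf.pt p) from rfl, e.left_inv hp.1]

/-- Two crossings at the same height coincide. [folklore] -/
theorem IsCrossing.eq_of_ht_eq {p q : F.Leaf x} (hp : IsCrossing e u₀ p) (hq : IsCrossing e u₀ q) (h : ht e p = ht e q) :
    p = q := by
  apply Leaf.injective_coe F x
  show Leaf.pt p = Leaf.pt q
  rw [hp.pt_eq, hq.pt_eq, h]

/-! ## Crossings are left to right -/

section Direction

variable [T2Space X] [SecondCountableTopology X] [NoncompactSpace (F.Leaf x)] {hbi : IsBiOriented F}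

/-- **Crossings are left to right.** Near a crossing `p` of the open leaf with the vertical
`u = u₀` of a box of the (bi-oriented) atlas, a point `q` of the leaf is after `p` iff it is
read to the right of the vertical, and before `p` iff it is read to its left. [folklore] -/
theorem eventually_leafLT_iff_lt_fst (he : e ∈ F.atlas) {p : F.Leaf x} (hp : IsCrossing e u₀ p) :
    ∀ᶠ q in 𝓝 p, Leaf.pt q ∈ e.source ∧ ht e q = ht e p ∧
      (leafLT hbi p q ↔ u₀ < (e (Leaf.pt q)).1) ∧ (leafLT hbi q p ↔ (e (Leaf.pt q)).1 < u₀) := by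
  -- the leaf arc of `e` through `p`
  have hpl : Leaf.pt p ∈ plaque e (ht e p) := mem_plaque_self hp.1
  have hsub : plaque e (ht e p) ⊆ F.leaf x := F.plaque_subset_leaf_of_mem he p.2 hpl
  set c := leafArc e (ht e p) hsub he with hc
  have hpc : p ∈ c.source := (mem_leafArc_source_iff hsub he).2 hpl
  filter_upwards [(isOpen_leafArc_source hsub he).mem_nhds hpc] with q hqc
  have hqpl : Leaf.pt q ∈ plaque e (ht e p) := (mem_leafArc_source_iff hsub he).1 hqc
  have hcq : c q = (e (Leaf.pt q)).1 := leafArc_apply hsub he hqc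
  have hcp : c p = u₀ := (leafArc_apply hsub he hpc).trans hp.2
  refine ⟨hqpl.1, hqpl.2, ?_, ?_⟩
  · rw [← leafArc_lt_iff (hbi := hbi) he hsub hpc hqc, hcp, hcq]
  · rw [← leafArc_lt_iff (hbi := hbi) he hsub hqc hpc, hcp, hcq]

/-- **Crossings are isolated along the leaf.** [folklore] -/
theorem eventually_not_isCrossing (hbi : IsBiOriented F) (he : e ∈ F.atlas) {p : F.Leaf x} (hp : IsCrossing e u₀ p) :
    ∀ᶠ q in 𝓝 p, q ≠ p → ¬ IsCrossing e u₀ q := by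
  filter_upwards [eventually_leafLT_iff_lt_fst (hbi := hbi) he hp] with q hq hne hcr
  rcases leafLT_trichotomy (hbi := hbi) p q with h | h | h
  · have := (hq.2.2.1).1 h
    rw [hcr.2] at this
    exact lt_irrefl _ this
  · exact hne h.symm
  · have := (hq.2.2.2).1 h
    rw [hcr.2] at this
    exact lt_irrefl _ this

omit [SecondCountableTopology X] [NoncompactSpace (F.Leaf x)] in
/-- The crossings with heights in a closed set form a closed subset of the leaf. [folklore] -/
theorem isClosed_setOf_isCrossing (he : e ∈ F.atlas) {T : Set ℝ} (hT : IsClosed T) (hTb : Bornology.IsBounded T) :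
    IsClosed {p : F.Leaf x | IsCrossing e u₀ p ∧ ht e p ∈ T} := by
  -- the vertical segment over `T` is compact in `X`
  have hsymm : Continuous e.symm := by
    have := e.continuousOn_symm; rw [F.target_eq e he, continuousOn_univ] at this; exact this
  obtain ⟨R, hR⟩ := hTb.subset_closedBall 0
  have hK : IsCompact (e.symm '' ({u₀} ×ˢ (T ∩ Metric.closedBall 0 R))) :=
    (isCompact_singleton.prod ((isCompact_closedBall (0 : ℝ) R).inter_left hT)).image hsymm
  have hcl : IsClosed (e.symm '' ({u₀} ×ˢ (T ∩ Metric.closedBall 0 R))) := hK.isClosed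
  have heq : {p : F.Leaf x | IsCrossing e u₀ p ∧ ht e p ∈ T} =
      (fun p : F.Leaf x ↦ Leaf.pt p) ⁻¹' (e.symm '' ({u₀} ×ˢ (T ∩ Metric.closedBall 0 R))) := by
    ext p
    constructor
    · rintro ⟨hp, hpT⟩
      exact ⟨(u₀, ht e p), ⟨rfl, hpT, hR hpT⟩, hp.pt_eq.symm⟩
    · rintro ⟨⟨u, t⟩, ⟨hu, htT, -⟩, hpt⟩
      simp only [mem_singleton_iff] at hu
      have hpt' : e.symm (u₀, t) = Leaf.pt p := by rw [← hu]; exact hpt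
      have hsrc : Leaf.pt p ∈ e.source := by rw [← hpt']; exact e.map_target (by rw [F.target_eq e he]; exact mem_univ _)
      have hep : e (Leaf.pt p) = (u₀, t) := by rw [← hpt', e.right_inv (by rw [F.target_eq e he]; exact mem_univ _)]
      exact ⟨⟨hsrc, by rw [hep]⟩, by rw [show ht e p = (e (Leaf.pt p)).2 from rfl, hep]; exact htT⟩
  rw [heq]
  exact hcl.preimage (Leaf.continuous_coe F x)

/-- The crossings with heights in a closed bounded set form a discrete subset of the leaf.
[folklore] -/
theorem isDiscrete_setOf_isCrossing (hbi : IsBiOriented F) (he : e ∈ F.atlas) (T : Set ℝ) :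
    IsDiscrete {p : F.Leaf x | IsCrossing e u₀ p ∧ ht e p ∈ T} := by
  rw [isDiscrete_iff_forall_mem_exists_isOpen]
  rintro p ⟨hp, hpT⟩
  obtain ⟨U, hU, hUo, hpU⟩ := mem_nhds_iff.1 (eventually_not_isCrossing hbi he hp)
  refine ⟨U, hUo, Subset.antisymm ?_ ?_⟩
  · rintro q ⟨hqU, hq, -⟩
    by_contra hne
    exact hU hqU hne hq
  · rintro q rfl
    exact ⟨hpU, hp, hpT⟩

/-- **Finitely many crossings in an order interval** (with heights in a closed bounded set).
[folklore] -/
theorem finite_crossings_leafIcc (hbi : IsBiOriented F) (he : e ∈ F.atlas) {T : Set ℝ} (hT : IsClosed T)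
    (hTb : Bornology.IsBounded T) (p q : F.Leaf x) :
    {r ∈ leafIcc hbi p q | IsCrossing e u₀ r ∧ ht e r ∈ T}.Finite := by
  have h : {r ∈ leafIcc hbi p q | IsCrossing e u₀ r ∧ ht e r ∈ T} =
      leafIcc hbi p q ∩ {r : F.Leaf x | IsCrossing e u₀ r ∧ ht e r ∈ T} := rfl
  rw [h]
  exact ((isCompact_leafIcc p q).inter_right (isClosed_setOf_isCrossing he hT hTb)).finite
    ((isDiscrete_setOf_isCrossing hbi he T).mono inter_subset_right)

/-- **The first crossing after a point.** If `q` is a crossing after `p` (with height in the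
closed bounded set `T`), there is a first crossing `r` with height in `T` in the order interval
`(p, q]`: no crossing with height in `T` lies strictly between `p` and `r`. [folklore] -/
theorem exists_first_crossing (he : e ∈ F.atlas) {T : Set ℝ} (hT : IsClosed T) (hTb : Bornology.IsBounded T)
    {p q : F.Leaf x} (hpq : leafLT hbi p q) (hq : IsCrossing e u₀ q) (hqT : ht e q ∈ T) :
    ∃ r, leafLT hbi p r ∧ ¬ leafLT hbi q r ∧ IsCrossing e u₀ r ∧ ht e r ∈ T ∧
      ∀ s, leafLT hbi p s → leafLT hbi s r → ¬ (IsCrossing e u₀ s ∧ ht e s ∈ T) := by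
  set S : Set (F.Leaf x) := {r ∈ leafIcc hbi p q | IsCrossing e u₀ r ∧ ht e r ∈ T} ∩ {r | leafLT hbi p r} with hS
  have hSf : S.Finite := (finite_crossings_leafIcc hbi he hT hTb p q).inter_of_left _
  have hqS : q ∈ S := ⟨⟨right_mem_leafIcc (leafLT_asymm hpq), hq, hqT⟩, hpq⟩
  obtain ⟨n, hn⟩ := exists_subset_lineCharts_source (hbi := hbi) (isCompact_leafIcc (hbi := hbi) p q)
  obtain ⟨r, hrS, hrmin⟩ := Set.exists_min_image S (lineCharts hbi x n) hSf ⟨q, hqS⟩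
  have hrI : r ∈ leafIcc hbi p q := hrS.1.1
  refine ⟨r, hrS.2, hrI.2, hrS.1.2.1, hrS.1.2.2, fun s hps hsr hs ↦ ?_⟩
  -- `s` is a competitor in `S` read strictly before `r`: contradiction with minimality
  have hsq : leafLT hbi s q := by
    rcases not_leafLT_iff.1 hrI.2 with h | h
    · exact leafLT_trans hsr h
    · exact h ▸ hsr
  have hsS : s ∈ S := ⟨⟨⟨leafLT_asymm hps, leafLT_asymm hsq⟩, hs⟩, hps⟩
  have hle := hrmin s hsS
  have hlt := (leafLT_iff (hn hsS.1.1) (hn hrI)).1 hsr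
  exact absurd hle (not_le.2 hlt)

end Direction

end Literature.Topology.PlanarFoliations
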